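import Literature.Geometry.Kaehler.AnalyticSetProduct
import Literature.Geometry.Kaehler.AnalyticSetChain
import Literature.Geometry.Kaehler.ComplexTorusAnalyticCycleClassUnion
import HarnessLib

/-!
# Products of analytic subsets: irreducibility and irreducible components

Layer `Literature/Geometry/Kaehler` (lane `lit-hodgefound`, Track 2 foundations, Layer A4; sequel to
`AnalyticSetProduct.lean`). For complex manifolds `M₁`, `M₂` (models `I₁`, `I₂`; the product `M₁ × M₂`
has model `I₁.prod I₂`) and analytic subsets `Z₁ ⊆ M₁`, `Z₂ ⊆ M₂`:

* §1 **slices** `{x₁} × Z₂`, `Z₁ × {x₂}` of irreducible sets are irreducible (they are the images of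
  `Z₂`, `Z₁` under the holomorphic embeddings `z ↦ (x₁, z)`, `z ↦ (z, x₂)`, along which a covering by
  two analytic sets pulls back);
* §2 **the product `Z₁ × Z₂` of irreducible analytic sets is irreducible** (`IsIrreducibleAnalyticSet.prod`).
  The classical slice argument (e.g. Shafarevich, *Basic Algebraic Geometry 1*, Ch. I §3.1 Thm. 3 for
  varieties; for analytic sets Chirka, *Complex Analytic Sets*, §5.3–5.4 with the uniqueness theorem
  §5.3 Cor. 2): if `Z₁ × Z₂ ⊆ A ∪ B`, the set `F_A = {z | Z₁ × {z} ⊆ A}` is closed; either `Z₂ ⊆ F_A`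
  (then `Z₁ × Z₂ ⊆ A`), or the open set `O = F_Aᶜ` meets `Z₂`, every slice `Z₁ × {z}`, `z ∈ Z₂ ∩ O`, lies
  in `B` (slices are irreducible), so each irreducible slice `{z₁} × Z₂` meets `B` in the nonempty
  relatively open part `{z₁} × (Z₂ ∩ O)` and lies in `B` by the **uniqueness theorem for irreducible
  analytic sets** (`IsIrreducibleAnalyticSet.subset_of_isOpen_inter_subset`, Chirka §5.3 Cor. 2);
* §3 **the irreducible components of `Z₁ × Z₂` are the products `C₁ × C₂` of irreducible components**
  (for `Z₁`, `Z₂` of pure dimension: `IsIrreducibleComponent.prod`, `IsIrreducibleComponent.exists_eq_prod`,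
  `isIrreducibleComponent_prod_iff`): `C₁ × C₂` is irreducible of the pure codimension of `Z₁ × Z₂`, and an
  irreducible `D ⊇ C₁ × C₂` inside `Z₁ × Z₂` lies in a component of the same codimension (Chirka §5.4
  Thm. (1)), which then equals `C₁ × C₂` (§5.3 Cor. 1); conversely a component `W = cl S` contains a
  regular point `(y₁, y₂)` with `yᵢ ∈ reg Zᵢ` (density of regular points), which lies on the component
  `C₁ × C₂`, `Cᵢ = cl S(yᵢ)`, and a regular point lies on exactly one component;
* §4 irreducibility and components along biholomorphisms between manifolds with different models
  (`IsIrreducibleAnalyticSet.preimage_homeomorph'`, `IsIrreducibleComponent.preimage_homeomorph`), and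
  §5 the complex-torus renderings through `prodHomeomorph Φ₁ Φ₂`
  (`isIrreducibleAnalyticSet_preimage_prodHomeomorph_prod`, `isIrreducibleComponent_preimage_prodHomeomorph_prod_iff`).

Theorems only (no definition, no named fact).

## References

* [Chirka1989] E. M. Chirka, *Complex Analytic Sets*, Kluwer (1989), §2.1 item 4 (products), §5.3 Cor. 1–2
  (uniqueness theorem for irreducible analytic sets, p. 55), §5.4 Thm. (irreducible components, p. 57).
* [GriffithsHarrisPrinciples1978] P. Griffiths, J. Harris, *Principles of Algebraic Geometry* (1978), Ch. 0 §2.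
* [LangeBirkenhake1992] H. Lange, Ch. Birkenhake, *Complex Abelian Varieties* (1992), §5.3.
-/

noncomputable section

open scoped Manifold Topology
open Set Function

namespace Literature.Geometry.Kaehler

section Prod

variable {E₁ : Type*} [NormedAddCommGroup E₁] [NormedSpace ℂ E₁] {H₁ : Type*} [TopologicalSpace H₁]
  {I₁ : ModelWithCorners ℂ E₁ H₁} {M₁ : Type*} [TopologicalSpace M₁] [ChartedSpace H₁ M₁]
  {E₂ : Type*} [NormedAddCommGroup E₂] [NormedSpace ℂ E₂] {H₂ : Type*} [TopologicalSpace H₂]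
  {I₂ : ModelWithCorners ℂ E₂ H₂} {M₂ : Type*} [TopologicalSpace M₂] [ChartedSpace H₂ M₂]
  [FiniteDimensional ℂ E₁] [FiniteDimensional ℂ E₂] [IsManifold I₁ 1 M₁] [IsManifold I₂ 1 M₂]
  [I₁.Boundaryless] [I₂.Boundaryless]

/-! ### §1 Slices of irreducible sets are irreducible -/

omit [FiniteDimensional ℂ E₁] [FiniteDimensional ℂ E₂] [IsManifold I₁ 1 M₁] [IsManifold I₂ 1 M₂]
  [I₁.Boundaryless] [I₂.Boundaryless] in
/-- The embedding `z ↦ (x₁, z)` of the second factor is holomorphic. [folklore] -/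
private theorem mdifferentiable_prodMk_left (x₁ : M₁) :
    MDifferentiable I₂ (I₁.prod I₂) (fun z : M₂ ↦ (x₁, z)) :=
  mdifferentiable_const.prodMk mdifferentiable_id

omit [FiniteDimensional ℂ E₁] [FiniteDimensional ℂ E₂] [IsManifold I₁ 1 M₁] [IsManifold I₂ 1 M₂]
  [I₁.Boundaryless] [I₂.Boundaryless] in
/-- The embedding `z ↦ (z, x₂)` of the first factor is holomorphic. [folklore] -/
private theorem mdifferentiable_prodMk_right (x₂ : M₂) :
    MDifferentiable I₁ (I₁.prod I₂) (fun z : M₁ ↦ (z, x₂)) :=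
  mdifferentiable_id.prodMk mdifferentiable_const

omit [FiniteDimensional ℂ E₂] [IsManifold I₂ 1 M₂] [I₁.Boundaryless] [I₂.Boundaryless] in
/-- **A slice `{x₁} × Z₂` of an irreducible analytic set `Z₂` is irreducible** in `M₁ × M₂` (a covering
of the slice by two analytic sets pulls back along the holomorphic embedding `z ↦ (x₁, z)` to a
covering of `Z₂`). [cite: Chirka1989, §2.1 item 4 and §5.3] -/
theorem IsIrreducibleAnalyticSet.singleton_prod (x₁ : M₁) {Z₂ : Set M₂}
    (h₂ : IsIrreducibleAnalyticSet I₂ Z₂) :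
    IsIrreducibleAnalyticSet (I₁.prod I₂) (({x₁} : Set M₁) ×ˢ Z₂) := by
  obtain ⟨hZ₂, ⟨z₀, hz₀⟩, hirr⟩ := h₂
  refine ⟨(isAnalyticSet_singleton x₁).prod hZ₂, ⟨(x₁, z₀), rfl, hz₀⟩, fun A B hA hB hAB ↦ ?_⟩
  have hA' := hA.preimage (mdifferentiable_prodMk_left (I₁ := I₁) (I₂ := I₂) x₁)
  have hB' := hB.preimage (mdifferentiable_prodMk_left (I₁ := I₁) (I₂ := I₂) x₁)
  rcases hirr _ _ hA' hB' (fun z hz ↦ hAB ⟨rfl, hz⟩) with h | h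
  · refine Or.inl ?_
    rintro ⟨p₁, p₂⟩ ⟨hp₁, hp₂⟩
    obtain rfl : p₁ = x₁ := hp₁
    exact h hp₂
  · refine Or.inr ?_
    rintro ⟨p₁, p₂⟩ ⟨hp₁, hp₂⟩
    obtain rfl : p₁ = x₁ := hp₁
    exact h hp₂

omit [FiniteDimensional ℂ E₁] [IsManifold I₁ 1 M₁] [I₁.Boundaryless] [I₂.Boundaryless] in
/-- **A slice `Z₁ × {x₂}` of an irreducible analytic set `Z₁` is irreducible** in `M₁ × M₂`.
[cite: Chirka1989, §2.1 item 4 and §5.3] -/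
theorem IsIrreducibleAnalyticSet.prod_singleton {Z₁ : Set M₁} (h₁ : IsIrreducibleAnalyticSet I₁ Z₁)
    (x₂ : M₂) : IsIrreducibleAnalyticSet (I₁.prod I₂) (Z₁ ×ˢ ({x₂} : Set M₂)) := by
  obtain ⟨hZ₁, ⟨z₀, hz₀⟩, hirr⟩ := h₁
  refine ⟨hZ₁.prod (isAnalyticSet_singleton x₂), ⟨(z₀, x₂), hz₀, rfl⟩, fun A B hA hB hAB ↦ ?_⟩
  have hA' := hA.preimage (mdifferentiable_prodMk_right (I₁ := I₁) (I₂ := I₂) x₂)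
  have hB' := hB.preimage (mdifferentiable_prodMk_right (I₁ := I₁) (I₂ := I₂) x₂)
  rcases hirr _ _ hA' hB' (fun z hz ↦ hAB ⟨hz, rfl⟩) with h | h
  · refine Or.inl ?_
    rintro ⟨p₁, p₂⟩ ⟨hp₁, hp₂⟩
    obtain rfl : p₂ = x₂ := hp₂
    exact h hp₁
  · refine Or.inr ?_
    rintro ⟨p₁, p₂⟩ ⟨hp₁, hp₂⟩
    obtain rfl : p₂ = x₂ := hp₂
    exact h hp₁

/-! ### §2 The product of irreducible analytic sets is irreducible -/

/-- **The product `Z₁ × Z₂` of irreducible analytic subsets is irreducible.** If `Z₁ × Z₂ ⊆ A ∪ B` with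
`A`, `B` analytic: the set `F = {z ∈ M₂ | Z₁ × {z} ⊆ A}` is closed; if `Z₂ ⊆ F` then `Z₁ × Z₂ ⊆ A`;
otherwise `O = Fᶜ` is an open set meeting `Z₂`, each slice `Z₁ × {z}` with `z ∈ Z₂ ∩ O` lies in `B`
(being irreducible and not in `A`), so every irreducible slice `{z₁} × Z₂` contains the nonempty
relatively open subset `{z₁} × (Z₂ ∩ O) ⊆ B` and lies in `B` by the uniqueness theorem for irreducible
analytic sets. [cite: Chirka1989, §5.3 Cor. 2, p. 55 (uniqueness theorem) and §2.1 item 4] -/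
theorem IsIrreducibleAnalyticSet.prod {Z₁ : Set M₁} {Z₂ : Set M₂} (h₁ : IsIrreducibleAnalyticSet I₁ Z₁)
    (h₂ : IsIrreducibleAnalyticSet I₂ Z₂) : IsIrreducibleAnalyticSet (I₁.prod I₂) (Z₁ ×ˢ Z₂) := by
  refine ⟨h₁.1.prod h₂.1, h₁.2.1.prod h₂.2.1, fun A B hA hB hAB ↦ ?_⟩
  -- the closed set of points of `M₂` whose slice lies in `A`
  set F : Set M₂ := {z | ∀ z₁ ∈ Z₁, (z₁, z) ∈ A} with hF
  have hFc : IsClosed F := by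
    have : F = ⋂ z₁ ∈ Z₁, (fun z : M₂ ↦ (z₁, z)) ⁻¹' A := by
      ext z
      simp only [hF, mem_setOf_eq, mem_iInter, mem_preimage]
    rw [this]
    exact isClosed_biInter fun z₁ _ ↦
      hA.isClosed.preimage (mdifferentiable_prodMk_left (I₁ := I₁) (I₂ := I₂) z₁).continuous
  by_cases hZF : Z₂ ⊆ F
  · exact Or.inl fun p hp ↦ hZF hp.2 p.1 hp.1
  · right
    obtain ⟨z₀, hz₀Z, hz₀F⟩ := not_subset.1 hZF
    -- every slice `Z₁ × {z}` with `z ∈ Z₂ \ F` lies in `B`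
    have hslice : ∀ z ∈ Z₂, z ∉ F → Z₁ ×ˢ ({z} : Set M₂) ⊆ B := by
      intro z hz hzF
      rcases (h₁.prod_singleton (I₂ := I₂) z).2.2 A B hA hB
        (fun p hp ↦ hAB ⟨hp.1, by rw [mem_singleton_iff.1 hp.2]; exact hz⟩) with h | h
      · exact absurd (fun z₁ hz₁ ↦ h (mk_mem_prod hz₁ (mem_singleton z))) hzF
      · exact h
    -- hence every slice `{z₁} × Z₂` lies in `B`, by the uniqueness theorem
    rintro ⟨p₁, p₂⟩ ⟨hp₁, hp₂⟩
    have hO : IsOpen (univ ×ˢ Fᶜ : Set (M₁ × M₂)) := isOpen_univ.prod hFc.isOpen_compl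
    refine (h₂.singleton_prod (I₁ := I₁) p₁).subset_of_isOpen_inter_subset hB hO
      ⟨(p₁, z₀), ⟨rfl, hz₀Z⟩, mem_univ _, hz₀F⟩ ?_ ⟨rfl, hp₂⟩
    rintro ⟨q₁, q₂⟩ ⟨⟨hq₁, hq₂⟩, -, hq₂F⟩
    obtain rfl : q₁ = p₁ := hq₁
    exact hslice q₂ hq₂ hq₂F ⟨hp₁, rfl⟩

/-! ### §3 Irreducible components of a product -/

/-- **Products of irreducible components are irreducible components** (for `Z₁`, `Z₂` of pure
codimension): `C₁ × C₂` is irreducible of the pure codimension `c₁ + c₂` of `Z₁ × Z₂`, and an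
irreducible `D` with `C₁ × C₂ ⊆ D ⊆ Z₁ × Z₂` lies in an irreducible component of `Z₁ × Z₂` (Chirka §5.4
Thm. (1)), of pure codimension `c₁ + c₂`, which therefore equals `C₁ × C₂` (§5.3 Cor. 1).
[cite: Chirka1989, §5.4 Thm., p. 57 and §5.3 Cor. 1, p. 55] -/
theorem IsIrreducibleComponent.prod {Z₁ C₁ : Set M₁} {Z₂ C₂ : Set M₂} {c₁ c₂ : ℕ}
    (hC₁ : IsIrreducibleComponent I₁ Z₁ C₁) (hZ₁ : HasPureCodim I₁ Z₁ c₁) (hZ₂ : HasPureCodim I₂ Z₂ c₂)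
    (hC₂ : IsIrreducibleComponent I₂ Z₂ C₂) :
    IsIrreducibleComponent (I₁.prod I₂) (Z₁ ×ˢ Z₂) (C₁ ×ˢ C₂) := by
  have hCirr : IsIrreducibleAnalyticSet (I₁.prod I₂) (C₁ ×ˢ C₂) :=
    hC₁.isIrreducibleAnalyticSet.prod hC₂.isIrreducibleAnalyticSet
  have hCc : HasPureCodim (I₁.prod I₂) (C₁ ×ˢ C₂) (c₁ + c₂) :=
    (hC₁.hasPureCodim hZ₁).prod (hC₂.hasPureCodim hZ₂)
  have hCZ : C₁ ×ˢ C₂ ⊆ Z₁ ×ˢ Z₂ := prod_mono hC₁.subset hC₂.subset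
  refine ⟨hCirr, hCZ, fun D hD hCD hDZ ↦ ?_⟩
  obtain ⟨W, hW, hDW⟩ := hD.exists_isIrreducibleComponent_superset (hZ₁.prod hZ₂).1 hDZ
  have hWc : HasPureCodim (I₁.prod I₂) W (c₁ + c₂) := hW.hasPureCodim (hZ₁.prod hZ₂)
  have hCW : C₁ ×ˢ C₂ = W :=
    hW.isIrreducibleAnalyticSet.eq_of_subset_of_hasPureCodim hWc hCc (hCD.trans hDW)
  exact Subset.antisymm (hDW.trans hCW.symm.subset) hCD

/-- `HasPureDim` form of `IsIrreducibleComponent.prod`. [cite: Chirka1989, §5.4 Thm., p. 57] -/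
theorem IsIrreducibleComponent.prod_of_hasPureDim {Z₁ C₁ : Set M₁} {Z₂ C₂ : Set M₂} {d₁ d₂ : ℕ}
    (hC₁ : IsIrreducibleComponent I₁ Z₁ C₁) (hZ₁ : HasPureDim I₁ Z₁ d₁) (hZ₂ : HasPureDim I₂ Z₂ d₂)
    (hC₂ : IsIrreducibleComponent I₂ Z₂ C₂) :
    IsIrreducibleComponent (I₁.prod I₂) (Z₁ ×ˢ Z₂) (C₁ ×ˢ C₂) :=
  hC₁.prod hZ₁.hasPureCodim hZ₂.hasPureCodim hC₂

/-- **Every irreducible component of `Z₁ × Z₂` is a product of irreducible components** (for `Z₁`, `Z₂`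
of pure codimension): a component `W = cl S`, `S` a connected component of `reg (Z₁ × Z₂)` (Chirka §5.4
Thm. (1)), contains — `S` being open in `Z₁ × Z₂` and regular points being dense in `Z₁`, `Z₂` — a point
`(y₁, y₂)` with `yᵢ ∈ reg Zᵢ`, which is a regular point of `Z₁ × Z₂` lying on the component
`cl S(y₁) × cl S(y₂)`; a regular point lies on exactly one component.
[cite: Chirka1989, §5.4 Thm., p. 57] -/
theorem IsIrreducibleComponent.exists_eq_prod {Z₁ : Set M₁} {Z₂ : Set M₂} {c₁ c₂ : ℕ}
    (hZ₁ : HasPureCodim I₁ Z₁ c₁) (hZ₂ : HasPureCodim I₂ Z₂ c₂) {W : Set (M₁ × M₂)}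
    (hW : IsIrreducibleComponent (I₁.prod I₂) (Z₁ ×ˢ Z₂) W) :
    ∃ C₁ C₂, IsIrreducibleComponent I₁ Z₁ C₁ ∧ IsIrreducibleComponent I₂ Z₂ C₂ ∧ W = C₁ ×ˢ C₂ := by
  have hZ : IsAnalyticSet (I₁.prod I₂) (Z₁ ×ˢ Z₂) := (hZ₁.prod hZ₂).1
  obtain ⟨y, hy, hWeq⟩ :=
    IsIrreducibleComponent.exists_eq_closure_connectedComponentIn_holds (I₁.prod I₂) (M₁ × M₂) hZ hW
  obtain ⟨N, hNo, hyN, hN⟩ :=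
    exists_isOpen_inter_subset_connectedComponentIn (mem_connectedComponentIn hy)
  obtain ⟨y₁, y₂⟩ := y
  obtain ⟨N₁, hN₁, N₂, hN₂, hNN⟩ := mem_nhds_prod_iff.1 (hNo.mem_nhds hyN)
  obtain ⟨⟨hy₁Z, hy₂Z⟩, -⟩ := hy
  obtain ⟨x₁, hx₁N, hx₁⟩ := mem_closure_iff_nhds.1
    (IsAnalyticSet.subset_closure_regularLocus_holds I₁ M₁ hZ₁.1 hy₁Z) N₁ hN₁
  obtain ⟨x₂, hx₂N, hx₂⟩ := mem_closure_iff_nhds.1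
    (IsAnalyticSet.subset_closure_regularLocus_holds I₂ M₂ hZ₂.1 hy₂Z) N₂ hN₂
  -- the regular point `(x₁, x₂)` of `Z₁ × Z₂` lies on `W` and on `cl S(x₁) × cl S(x₂)`
  have hxreg : (x₁, x₂) ∈ regularLocus (I₁.prod I₂) (Z₁ ×ˢ Z₂) :=
    prod_regularLocus_subset Z₁ Z₂ (mk_mem_prod hx₁ hx₂)
  have hxW : (x₁, x₂) ∈ W := by
    rw [hWeq]
    exact subset_closure (hN ⟨mk_mem_prod hx₁.1 hx₂.1, hNN (mk_mem_prod hx₁N hx₂N)⟩)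
  have hC₁ := isIrreducibleComponent_closure_connectedComponentIn hZ₁.1 hx₁
  have hC₂ := isIrreducibleComponent_closure_connectedComponentIn hZ₂.1 hx₂
  refine ⟨_, _, hC₁, hC₂, hW.eq_of_mem_regularLocus hZ (hC₁.prod hZ₁ hZ₂ hC₂) hxreg hxW ?_⟩
  exact mk_mem_prod (subset_closure (mem_connectedComponentIn hx₁))
    (subset_closure (mem_connectedComponentIn hx₂))

/-- **The irreducible components of `Z₁ × Z₂` are exactly the products of irreducible components**
(`Z₁`, `Z₂` of pure codimension). [cite: Chirka1989, §5.4 Thm., p. 57] -/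
theorem isIrreducibleComponent_prod_iff {Z₁ : Set M₁} {Z₂ : Set M₂} {c₁ c₂ : ℕ}
    (hZ₁ : HasPureCodim I₁ Z₁ c₁) (hZ₂ : HasPureCodim I₂ Z₂ c₂) {W : Set (M₁ × M₂)} :
    IsIrreducibleComponent (I₁.prod I₂) (Z₁ ×ˢ Z₂) W ↔
      ∃ C₁ C₂, IsIrreducibleComponent I₁ Z₁ C₁ ∧ IsIrreducibleComponent I₂ Z₂ C₂ ∧ W = C₁ ×ˢ C₂ := by
  refine ⟨fun hW ↦ hW.exists_eq_prod hZ₁ hZ₂, ?_⟩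
  rintro ⟨C₁, C₂, hC₁, hC₂, rfl⟩
  exact hC₁.prod hZ₁ hZ₂ hC₂

/-- `HasPureDim` form of `isIrreducibleComponent_prod_iff`. [cite: Chirka1989, §5.4 Thm., p. 57] -/
theorem isIrreducibleComponent_prod_iff_of_hasPureDim {Z₁ : Set M₁} {Z₂ : Set M₂} {d₁ d₂ : ℕ}
    (hZ₁ : HasPureDim I₁ Z₁ d₁) (hZ₂ : HasPureDim I₂ Z₂ d₂) {W : Set (M₁ × M₂)} :
    IsIrreducibleComponent (I₁.prod I₂) (Z₁ ×ˢ Z₂) W ↔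
      ∃ C₁ C₂, IsIrreducibleComponent I₁ Z₁ C₁ ∧ IsIrreducibleComponent I₂ Z₂ C₂ ∧ W = C₁ ×ˢ C₂ :=
  isIrreducibleComponent_prod_iff hZ₁.hasPureCodim hZ₂.hasPureCodim

omit [FiniteDimensional ℂ E₁] [FiniteDimensional ℂ E₂] [IsManifold I₁ 1 M₁] [IsManifold I₂ 1 M₂]
  [I₁.Boundaryless] [I₂.Boundaryless] in
/-- A product of irreducible components determines its factors (both being nonempty).
[cite: Chirka1989, §5.4 Thm., p. 57] -/
theorem IsIrreducibleComponent.prod_eq_prod_iff {Z₁ C₁ : Set M₁} {C₁' : Set M₁} {Z₂ C₂ : Set M₂}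
    {C₂' : Set M₂} (hC₁ : IsIrreducibleComponent I₁ Z₁ C₁) (hC₂ : IsIrreducibleComponent I₂ Z₂ C₂) :
    C₁ ×ˢ C₂ = C₁' ×ˢ C₂' ↔ C₁ = C₁' ∧ C₂ = C₂' := by
  refine ⟨fun h ↦ ?_, fun h ↦ by rw [h.1, h.2]⟩
  rcases Set.prod_eq_prod_iff.1 h with h' | ⟨h₁, -⟩
  · exact h'
  · rcases h₁ with h₁ | h₁
    · exact absurd h₁ hC₁.nonempty.ne_empty
    · exact absurd h₁ hC₂.nonempty.ne_empty

end Prod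

/-! ### §4 Irreducibility and components along biholomorphisms (two models) -/

section Transport

variable {E : Type*} [NormedAddCommGroup E] [NormedSpace ℂ E] {H : Type*} [TopologicalSpace H]
  {I : ModelWithCorners ℂ E H} {M : Type*} [TopologicalSpace M] [ChartedSpace H M]
  {E' : Type*} [NormedAddCommGroup E'] [NormedSpace ℂ E'] {H' : Type*} [TopologicalSpace H']
  {I' : ModelWithCorners ℂ E' H'} {M' : Type*} [TopologicalSpace M'] [ChartedSpace H' M']

/-- **Irreducibility is invariant under biholomorphisms** (two models): if `h : M ≃ₜ M'` is holomorphic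
with holomorphic inverse and `Z ⊆ M'` is irreducible, so is `h ⁻¹' Z` (a covering `h ⁻¹' Z ⊆ A ∪ B` gives
`Z ⊆ h.symm ⁻¹' A ∪ h.symm ⁻¹' B`). [cite: Chirka1989, §5.3] -/
theorem IsIrreducibleAnalyticSet.preimage_homeomorph' (h : M ≃ₜ M') (hh : MDifferentiable I I' h)
    (hh' : MDifferentiable I' I h.symm) {Z : Set M'} (hZ : IsIrreducibleAnalyticSet I' Z) :
    IsIrreducibleAnalyticSet I (h ⁻¹' Z) := by
  obtain ⟨hZa, ⟨z, hz⟩, hirr⟩ := hZ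
  refine ⟨hZa.preimage hh, ⟨h.symm z, by rwa [mem_preimage, Homeomorph.apply_symm_apply]⟩,
    fun A B hA hB hAB ↦ ?_⟩
  have hsub : Z ⊆ h.symm ⁻¹' A ∪ h.symm ⁻¹' B := fun w hw ↦ by
    have : h.symm w ∈ h ⁻¹' Z := by rwa [mem_preimage, Homeomorph.apply_symm_apply]
    simpa only [mem_union, mem_preimage] using hAB this
  rcases hirr _ _ (hA.preimage hh') (hB.preimage hh') hsub with h₁ | h₁
  · exact Or.inl fun x hx ↦ by simpa using h₁ hx
  · exact Or.inr fun x hx ↦ by simpa using h₁ hx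

/-- **Irreducible components are invariant under biholomorphisms** (two models): if `C` is an
irreducible component of `Z ⊆ M'`, then `h ⁻¹' C` is an irreducible component of `h ⁻¹' Z`.
[cite: Chirka1989, §5.4] -/
theorem IsIrreducibleComponent.preimage_homeomorph (h : M ≃ₜ M') (hh : MDifferentiable I I' h)
    (hh' : MDifferentiable I' I h.symm) {Z C : Set M'} (hC : IsIrreducibleComponent I' Z C) :
    IsIrreducibleComponent I (h ⁻¹' Z) (h ⁻¹' C) := by
  refine ⟨hC.isIrreducibleAnalyticSet.preimage_homeomorph' h hh hh', preimage_mono hC.subset,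
    fun D hD hCD hDZ ↦ ?_⟩
  have hh'' : MDifferentiable I I' h.symm.symm := by simpa only [Homeomorph.symm_symm] using hh
  have hD' : IsIrreducibleAnalyticSet I' (h.symm ⁻¹' D) := hD.preimage_homeomorph' h.symm hh' hh''
  have hCD' : C ⊆ h.symm ⁻¹' D := fun w hw ↦ by
    have : h.symm w ∈ h ⁻¹' C := by rwa [mem_preimage, Homeomorph.apply_symm_apply]
    exact hCD this
  have hDZ' : h.symm ⁻¹' D ⊆ Z := fun w hw ↦ by
    have := hDZ hw
    rwa [mem_preimage, Homeomorph.apply_symm_apply] at this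
  have heq : h.symm ⁻¹' D = C := hC.2.2 _ hD' hCD' hDZ'
  refine Subset.antisymm (fun x hx ↦ ?_) hCD
  have : h x ∈ h.symm ⁻¹' D := by rwa [mem_preimage, Homeomorph.symm_apply_apply]
  rw [heq] at this
  exact this

/-- Along a biholomorphism, `W` is a component of `h ⁻¹' Z` iff `W = h ⁻¹' C` for a component `C` of `Z`.
[cite: Chirka1989, §5.4] -/
theorem isIrreducibleComponent_preimage_homeomorph_iff (h : M ≃ₜ M') (hh : MDifferentiable I I' h)
    (hh' : MDifferentiable I' I h.symm) {Z : Set M'} {W : Set M} :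
    IsIrreducibleComponent I (h ⁻¹' Z) W ↔ ∃ C, IsIrreducibleComponent I' Z C ∧ W = h ⁻¹' C := by
  have hh'' : MDifferentiable I I' h.symm.symm := by simpa only [Homeomorph.symm_symm] using hh
  constructor
  · intro hW
    refine ⟨h.symm ⁻¹' W, ?_, ?_⟩
    · have := hW.preimage_homeomorph h.symm hh' hh''
      rwa [← preimage_comp, Homeomorph.self_comp_symm, preimage_id] at this
    · rw [← preimage_comp, Homeomorph.symm_comp_self, preimage_id]
  · rintro ⟨C, hC, rfl⟩
    exact hC.preimage_homeomorph h hh hh'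

end Transport

/-! ### §5 Products of analytic subsets of complex tori -/

namespace ComplexTorus

variable {ι₁ ι₂ : Type*} [Fintype ι₁] [Fintype ι₂] {E₁ E₂ : Type*} [NormedAddCommGroup E₁]
  [NormedSpace ℂ E₁] [NormedAddCommGroup E₂] [NormedSpace ℂ E₂] [FiniteDimensional ℂ E₁]
  [FiniteDimensional ℂ E₂] (Φ₁ : (ι₁ → ℝ) ≃L[ℝ] E₁) (Φ₂ : (ι₂ → ℝ) ≃L[ℝ] E₂)

/-- **The product `Z₁ × Z₂` of irreducible analytic subsets of complex tori is an irreducible analytic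
subset of the product torus** `ComplexTorus (prodPeriod Φ₁ Φ₂)` (through `prodHomeomorph`).
[cite: Chirka1989, §5.3 Cor. 2 and §2.1 item 4] -/
theorem isIrreducibleAnalyticSet_preimage_prodHomeomorph_prod {Z₁ : Set (ComplexTorus Φ₁)}
    {Z₂ : Set (ComplexTorus Φ₂)} (h₁ : IsIrreducibleAnalyticSet 𝓘(ℂ, E₁) Z₁)
    (h₂ : IsIrreducibleAnalyticSet 𝓘(ℂ, E₂) Z₂) :
    IsIrreducibleAnalyticSet 𝓘(ℂ, E₁ × E₂) (prodHomeomorph Φ₁ Φ₂ ⁻¹' (Z₁ ×ˢ Z₂)) :=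
  (h₁.prod h₂).preimage_homeomorph' (prodHomeomorph Φ₁ Φ₂) (mdifferentiable_prodHomeomorph Φ₁ Φ₂)
    (mdifferentiable_prodHomeomorph_symm Φ₁ Φ₂)

/-- **The irreducible components of `Z₁ × Z₂` in the product torus are the products `C₁ × C₂` of
irreducible components** (`Z₁`, `Z₂` analytic of pure dimension). [cite: Chirka1989, §5.4 Thm., p. 57] -/
theorem isIrreducibleComponent_preimage_prodHomeomorph_prod_iff {Z₁ : Set (ComplexTorus Φ₁)}
    {Z₂ : Set (ComplexTorus Φ₂)} {d₁ d₂ : ℕ} (h₁ : HasPureDim 𝓘(ℂ, E₁) Z₁ d₁)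
    (h₂ : HasPureDim 𝓘(ℂ, E₂) Z₂ d₂) {W : Set (ComplexTorus (prodPeriod Φ₁ Φ₂))} :
    IsIrreducibleComponent 𝓘(ℂ, E₁ × E₂) (prodHomeomorph Φ₁ Φ₂ ⁻¹' (Z₁ ×ˢ Z₂)) W ↔
      ∃ C₁ C₂, IsIrreducibleComponent 𝓘(ℂ, E₁) Z₁ C₁ ∧ IsIrreducibleComponent 𝓘(ℂ, E₂) Z₂ C₂ ∧
        W = prodHomeomorph Φ₁ Φ₂ ⁻¹' (C₁ ×ˢ C₂) := by
  rw [isIrreducibleComponent_preimage_homeomorph_iff (prodHomeomorph Φ₁ Φ₂)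
    (mdifferentiable_prodHomeomorph Φ₁ Φ₂) (mdifferentiable_prodHomeomorph_symm Φ₁ Φ₂)]
  constructor
  · rintro ⟨C, hC, rfl⟩
    obtain ⟨C₁, C₂, hC₁, hC₂, rfl⟩ := (isIrreducibleComponent_prod_iff_of_hasPureDim h₁ h₂).1 hC
    exact ⟨C₁, C₂, hC₁, hC₂, rfl⟩
  · rintro ⟨C₁, C₂, hC₁, hC₂, rfl⟩
    exact ⟨C₁ ×ˢ C₂, hC₁.prod_of_hasPureDim h₁ h₂ hC₂, rfl⟩

/-- In particular `C₁ × C₂` is an irreducible component of `Z₁ × Z₂` in the product torus.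
[cite: Chirka1989, §5.4 Thm., p. 57] -/
theorem isIrreducibleComponent_preimage_prodHomeomorph_prod {Z₁ C₁ : Set (ComplexTorus Φ₁)}
    {Z₂ C₂ : Set (ComplexTorus Φ₂)} {d₁ d₂ : ℕ} (h₁ : HasPureDim 𝓘(ℂ, E₁) Z₁ d₁)
    (h₂ : HasPureDim 𝓘(ℂ, E₂) Z₂ d₂) (hC₁ : IsIrreducibleComponent 𝓘(ℂ, E₁) Z₁ C₁)
    (hC₂ : IsIrreducibleComponent 𝓘(ℂ, E₂) Z₂ C₂) :
    IsIrreducibleComponent 𝓘(ℂ, E₁ × E₂) (prodHomeomorph Φ₁ Φ₂ ⁻¹' (Z₁ ×ˢ Z₂))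
      (prodHomeomorph Φ₁ Φ₂ ⁻¹' (C₁ ×ˢ C₂)) :=
  (isIrreducibleComponent_preimage_prodHomeomorph_prod_iff Φ₁ Φ₂ h₁ h₂).2 ⟨C₁, C₂, hC₁, hC₂, rfl⟩

end ComplexTorus

end Literature.Geometry.Kaehler
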